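import Summits.Ventures.WeilGRH.TwistedGramEvenReal
import Literature.NumberTheory.LFunctions.YoshidaWindowGramFrontDoor
import HarnessLib

/-!
# GRH arm (rh-explicit, venture WeilGRH): twisted format C — the kernel ENTRY BOX of `twistedGramCoeff χ a n m`
  for a real Dirichlet character (the (E) brick of the χ instance lane)

Cell `rh-explicit`, WEIL TRACK — GRH ARM (engine seat weil-grh-2 gen7).  weil-grh-5's data-only door
`weilPositivityOnChar_of_twisted_formatC_data` (`TwistedDataRung.lean`) consumes, per cell `(χ, a)`, a kernel
certificate about the real matrices built from `twistedGramCoeff χ a n m` (`TwistedGramEvenReal.lean`,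
`= gramCoeff − polarCoeff + Σ_{log k<2a}(Re χ(k) − 1)Λ(k)k^{-1/2}(incrCoeff − 2δ) + (log q)δ`).  The `ζ` instance
lane encloses `gramCoeff a n m` by `Yoshida1992.Encl.gramBox` (part III of weil-2's `YoshidaWindowGram*` kit:
valid constants `ConstsValid`, per-mode special-value records `OffValid`/`DiagValid`, certified once per mode by
`Encl.checkTable`).  This file is the χ-twist of that one brick, with NO new transcendental input:

* `TwistedEncl.primeDiagSum` / `TwistedEncl.primeOffSum` — the prime sums of (5.15)/(5.16) with every prime power
  `k_i` re-weighted by an INTEGER `ε_i` (`= Re χ(k_i) ∈ {0, ±1}` for a real character), `mem_…` lemmas;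
* `TwistedEncl.twistedGramBox S C εs LQ Rn Rm n m : MI` — the entry box: archimedean part of `gramBox` (no polar
  box), minus the `ε`-weighted diagonal prime sum / plus the off-diagonal one, plus `LQ ∋ log q` on the diagonal;
* ★ `TwistedEncl.mem_twistedGramBox` — SOUNDNESS: for valid constants/records, prime data `ks` of the window,
  a character `χ` mod `q` with `Re χ(k_i) = ε_i` on the listed prime powers and `log q ∈ LQ`:
  `twistedGramCoeff χ a n m ∈ twistedGramBox S C εs LQ Rn Rm n m`.

So a χ-cell's entry files are the `ζ` ones with three literal changes (integer weights, no polar box, `+log q`), and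
the SAME certified special-value tables (`Encl.checkTable`) serve every character at a given window `a`.
Sizing (this seat's twin of the door, kit j190345): the even real finite remainder closes at ORDER 1 with blocks
`B⁺ ≤ 16`, `B₃⁺ ≤ 128`, `B⁻ ≤ 32`, `B₃⁻ ≤ 256` (e.g. `(5/·)` at `4023/5000`: `8 × 64`; `(8/·)` at `t = 1`: `16 × 128`),
two to three orders of magnitude below the `ζ` K-cells.  Everything is PROVED; computable `def`s (kernel data
functions) with docstrings; no named facts; RH/GRH-free.  References: H. Yoshida (1992) §5 (5.15)/(5.16) p. 301
[Yoshida1992HermitianForms]; R. E. Moore (1966) Ch. 3 [Moore1966]; A. Weil (1952) (11) [Weil1952FormulesExplicites].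
-/

set_option autoImplicit false

open Real Complex Finset
open scoped BigOperators ArithmeticFunction.vonMangoldt

namespace Summit.Ventures.WeilGRH

open Literature.NumberTheory.LFunctions Literature.NumberTheory.LFunctions.Yoshida1992
open Literature.NumberTheory.LFunctions.Yoshida1992.Encl
open Literature.Analysis.SpecialFunctions Literature.Analysis.ValidatedNumerics.NumericsMP

namespace TwistedEncl

variable {S : ℕ} {a : ℝ} {q : ℕ}

/-! ## The `ε`-weighted prime sums -/

/-- `Σ_{i<k} ε_i · wt_i · w_i · Re cs_i` — the diagonal prime sum of (5.15) with integer weights `ε_i`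
(`= Re χ(k_i)` for a real character). [cite: Yoshida1992HermitianForms, §5 (5.15) p. 301] -/
def primeDiagSum (S : ℕ) (εs : List ℤ) (wts ws : List MI) (cs : List MC) : ℕ → MI
  | 0 => MI.ofInt S 0
  | i + 1 => (primeDiagSum S εs wts ws cs i).add
      ((((wts.getD i default).mulInt (εs.getD i 0)).mul S (ws.getD i default)).mul S (cs.getD i default).re)

/-- `Σ_{i<k} ε_i · wt_i · (Im csm_i − Im csn_i)` — the off-diagonal prime sum of (5.16) with integer weights.
[cite: Yoshida1992HermitianForms, §5 (5.16) p. 301] -/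
def primeOffSum (S : ℕ) (εs : List ℤ) (wts : List MI) (csn csm : List MC) : ℕ → MI
  | 0 => MI.ofInt S 0
  | i + 1 => (primeOffSum S εs wts csn csm i).add
      (((wts.getD i default).mulInt (εs.getD i 0)).mul S (((csm.getD i default).im).sub (csn.getD i default).im))

/-- `primeDiagSum` encloses `Σ_{i<k} ε_i Λ_i (2 − ℓ_i/a) cos(ω_n ℓ_i)`. [cite: Moore1966, Ch. 3 (interval arithmetic: inclusion property)] -/
theorem mem_primeDiagSum (hS : 0 < S) {ks : List PrimeLen} {C : Consts} (hC : ConstsValid S a ks C)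
    (εs : List ℤ) {n : ℤ} {R : IdxRec} (hR : OffValid S a ks n R) :
    ∀ k, k ≤ ks.length → MI.mem S (∑ i ∈ Finset.range k,
      ((εs.getD i 0 : ℤ) : ℝ) * (ks.getD i default).wt * (2 - (ks.getD i default).len / a) *
        Real.cos (freq a n * (ks.getD i default).len))
      (primeDiagSum S εs C.wts C.ws R.cs k)
  | 0, _ => by simpa [primeDiagSum] using MI.mem_ofInt S 0
  | k + 1, hk => by
      rw [Finset.sum_range_succ, primeDiagSum]
      have hk' : k < ks.length := hk
      have hcos : MI.mem S (Real.cos (freq a n * (ks.getD k default).len)) (R.cs.getD k default).re := by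
        have := (hR.cs k hk').1
        rwa [Complex.exp_ofReal_mul_I_re] at this
      have hw : MI.mem S ((ks.getD k default).wt * ((εs.getD k 0 : ℤ) : ℝ)) ((C.wts.getD k default).mulInt (εs.getD k 0)) :=
        MI.mem_mulInt (hC.wts k hk') _
      refine MI.mem_add (mem_primeDiagSum hS hC εs hR k (by omega)) ?_
      refine mem_of_eq (MI.mem_mul hS (MI.mem_mul hS hw (hC.ws k hk')) hcos) ?_
      ring

/-- `primeOffSum` encloses `Σ_{i<k} ε_i Λ_i (sin(ω_m ℓ_i) − sin(ω_n ℓ_i))`. [cite: Moore1966, Ch. 3 (interval arithmetic: inclusion property)] -/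
theorem mem_primeOffSum (hS : 0 < S) {ks : List PrimeLen} {C : Consts} (hC : ConstsValid S a ks C)
    (εs : List ℤ) {n m : ℤ} {Rn Rm : IdxRec} (hn : OffValid S a ks n Rn) (hm : OffValid S a ks m Rm) :
    ∀ k, k ≤ ks.length → MI.mem S (∑ i ∈ Finset.range k,
      ((εs.getD i 0 : ℤ) : ℝ) * (ks.getD i default).wt *
        (Real.sin (freq a m * (ks.getD i default).len) - Real.sin (freq a n * (ks.getD i default).len)))
      (primeOffSum S εs C.wts Rn.cs Rm.cs k)
  | 0, _ => by simpa [primeOffSum] using MI.mem_ofInt S 0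
  | k + 1, hk => by
      rw [Finset.sum_range_succ, primeOffSum]
      have hk' : k < ks.length := hk
      have hsn : MI.mem S (Real.sin (freq a n * (ks.getD k default).len)) (Rn.cs.getD k default).im := by
        have := (hn.cs k hk').2
        rwa [Complex.exp_ofReal_mul_I_im] at this
      have hsm : MI.mem S (Real.sin (freq a m * (ks.getD k default).len)) (Rm.cs.getD k default).im := by
        have := (hm.cs k hk').2
        rwa [Complex.exp_ofReal_mul_I_im] at this
      have hw : MI.mem S ((ks.getD k default).wt * ((εs.getD k 0 : ℤ) : ℝ)) ((C.wts.getD k default).mulInt (εs.getD k 0)) :=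
        MI.mem_mulInt (hC.wts k hk') _
      refine MI.mem_add (mem_primeOffSum hS hC εs hn hm k (by omega)) ?_
      refine mem_of_eq (MI.mem_mul hS hw (MI.mem_sub hsm hsn)) ?_
      ring

/-! ## The twisted entry box -/

/-- **The twisted entry box**: an interval for `twistedGramCoeff χ a n m` from the constants `C`, the integer
weights `εs` (`ε_i = Re χ(k_i)`), an interval `LQ ∋ log q` and the two index records — diagonal (5.15) without the
polar term, minus the `ε`-weighted prime sum, plus `log q`; off-diagonal (5.16) without the polar term.
[cite: Yoshida1992HermitianForms, §5 (5.15)-(5.16) p. 301] -/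
def twistedGramBox (S : ℕ) (C : Consts) (εs : List ℤ) (LQ : MI) (Rn Rm : IdxRec) (n m : ℤ) : MI :=
  if n = m then
    ((((Rn.reP.sub C.logPi).add ((Rn.rePD.mul S C.invA).divNat 4)).sub (Rn.eD.mul S C.invA)).sub
      (primeDiagSum S εs C.wts C.ws Rn.cs C.wts.length)).add LQ
  else
    (offScale S C n m (primeOffSum S εs C.wts Rn.cs Rm.cs C.wts.length)).add
      (offScale S C n m (((Rm.imP.divNat 2).sub Rm.eS).sub ((Rn.imP.divNat 2).sub Rn.eS)))

/-- The twisted coefficient in LIST form over prime data `ks` with integer weights `εs`: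
`Σ_i ε_i wt_i (K_{ℓ_i}(n,m) − 2δ_{nm}) + archCoeff a n m + (log q)δ_{nm}`.
[cite: Yoshida1992HermitianForms, §5 (5.15)-(5.16) p. 301] -/
noncomputable def twistedGramCoeffList (a : ℝ) (ks : List PrimeLen) (εs : List ℤ) (Lq : ℝ) (n m : ℤ) : ℝ :=
  (∑ i ∈ Finset.range ks.length, ((εs.getD i 0 : ℤ) : ℝ) * (ks.getD i default).wt *
      (incrCoeff a (ks.getD i default).len n m - if n = m then 2 else 0)) +
    archCoeff a n m + if n = m then Lq else 0

/-- **`twistedGramCoeff` IS the list form** on the prime data of the window, for a character whose real parts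
on the listed prime powers are the integers `εs`. [cite: Yoshida1992HermitianForms, §5 (5.15)-(5.16) p. 301] -/
theorem twistedGramCoeff_eq_list {ks : List PrimeLen} (hks : PrimeData a ks) (χ : DirichletCharacter ℂ q)
    {εs : List ℤ} (hε : ∀ i < ks.length, (χ (((ks.getD i default).val : ℕ) : ZMod q)).re = ((εs.getD i 0 : ℤ) : ℝ))
    (n m : ℤ) :
    twistedGramCoeff χ a n m = twistedGramCoeffList a ks εs (Real.log q) n m := by
  unfold twistedGramCoeff twistedGramCoeffList gramCoeff
  -- the two prime sums over the window as range sums over the prime data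
  have h1 : primeCoeff a n m = ∑ i ∈ Finset.range ks.length,
      (ks.getD i default).wt * (incrCoeff a (ks.getD i default).len n m - if n = m then 2 else 0) := by
    rw [primeCoeff_eq_listSum hks, list_sum_map_eq_sum_range]
  have h2 : (∑ k ∈ weilPrimeIndex a, ((χ (k : ZMod q)).re - 1) * ((Λ k : ℝ) / Real.sqrt k) *
      (incrCoeff a (Real.log k) n m - if n = m then 2 else 0)) =
      ∑ i ∈ Finset.range ks.length, (ks.getD i default).wt *
        (((χ (((ks.getD i default).val : ℕ) : ZMod q)).re - 1) *
          (incrCoeff a (ks.getD i default).len n m - if n = m then 2 else 0)) := by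
    have h := sum_weilPrimeIndex_eq_listSum hks
      (fun k ↦ ((χ (k : ZMod q)).re - 1) * (incrCoeff a (Real.log k) n m - if n = m then 2 else 0))
    rw [list_sum_map_eq_sum_range] at h
    simp only [PrimeLen.log_val] at h
    rw [← h]
    refine Finset.sum_congr rfl fun k _ ↦ ?_
    ring
  rw [h1, h2]
  have h3 : ∀ i ∈ Finset.range ks.length,
      (ks.getD i default).wt * (incrCoeff a (ks.getD i default).len n m - if n = m then 2 else 0) +
        (ks.getD i default).wt * (((χ (((ks.getD i default).val : ℕ) : ZMod q)).re - 1) *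
          (incrCoeff a (ks.getD i default).len n m - if n = m then 2 else 0)) =
      ((εs.getD i 0 : ℤ) : ℝ) * (ks.getD i default).wt *
        (incrCoeff a (ks.getD i default).len n m - if n = m then 2 else 0) := by
    intro i hi
    rw [← hε i (Finset.mem_range.mp hi)]
    ring
  have h4 := Finset.sum_congr rfl h3
  rw [Finset.sum_add_distrib] at h4
  linarith [h4]

/-- **The twisted entry box is sound (list form, no hypothesis on `ks`).**
[cite: Yoshida1992HermitianForms, §5 (5.15)-(5.16) p. 301] -/
theorem mem_twistedGramBox_list (hS : 0 < S) (ha0 : 0 < a) {ks : List PrimeLen} {C : Consts}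
    (hC : ConstsValid S a ks C) (εs : List ℤ) {Lq : ℝ} {LQ : MI} (hLQ : MI.mem S Lq LQ) {n m : ℤ} {Rn Rm : IdxRec}
    (hn : OffValid S a ks n Rn) (hnd : n = m → DiagValid S a n Rn) (hm : OffValid S a ks m Rm) :
    MI.mem S (twistedGramCoeffList a ks εs Lq n m) (twistedGramBox S C εs LQ Rn Rm n m) := by
  unfold twistedGramBox twistedGramCoeffList
  by_cases hnm : n = m
  · -- diagonal entry (5.15) without the polar term
    subst hnm
    have hd := hnd rfl
    simp only [if_true]
    have hpri : MI.mem S (-(∑ i ∈ Finset.range ks.length, ((εs.getD i 0 : ℤ) : ℝ) * (ks.getD i default).wt *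
        (incrCoeff a (ks.getD i default).len n n - 2)))
        (primeDiagSum S εs C.wts C.ws Rn.cs C.wts.length) := by
      rw [hC.wts_len]
      refine mem_of_eq (mem_primeDiagSum hS hC εs hn ks.length le_rfl) ?_
      rw [← Finset.sum_neg_distrib]
      refine Finset.sum_congr rfl fun i _ ↦ ?_
      unfold incrCoeff
      simp only [if_true]
      ring
    have harch : MI.mem S (archCoeff a n n)
        (((Rn.reP.sub C.logPi).add ((Rn.rePD.mul S C.invA).divNat 4)).sub (Rn.eD.mul S C.invA)) := by
      unfold archCoeff
      simp only [if_true]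
      have h := MI.mem_sub (MI.mem_add (MI.mem_sub hd.reP hC.logPi)
        (MI.mem_divNat (MI.mem_mul hS hd.rePD hC.invA) (n := 4) (by norm_num))) (MI.mem_mul hS hd.eD hC.invA)
      refine mem_of_eq h ?_
      have ha' : a ≠ 0 := ha0.ne'
      push_cast
      field_simp
    refine mem_of_eq (MI.mem_add (MI.mem_sub harch hpri) hLQ) ?_
    ring
  · -- off-diagonal entry (5.16) without the polar term
    simp only [hnm, if_false]
    have hpri : MI.mem S (∑ i ∈ Finset.range ks.length, ((εs.getD i 0 : ℤ) : ℝ) * (ks.getD i default).wt *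
        (incrCoeff a (ks.getD i default).len n m - 0))
        (offScale S C n m (primeOffSum S εs C.wts Rn.cs Rm.cs C.wts.length)) := by
      rw [hC.wts_len]
      refine mem_of_eq (mem_offScale hS hC hnm (mem_primeOffSum hS hC εs hn hm ks.length le_rfl)) ?_
      rw [Finset.mul_sum]
      refine Finset.sum_congr rfl fun i _ ↦ ?_
      unfold incrCoeff
      simp only [hnm, if_false]
      ring
    have harch : MI.mem S (archCoeff a n m)
        (offScale S C n m (((Rm.imP.divNat 2).sub Rm.eS).sub ((Rn.imP.divNat 2).sub Rn.eS))) := by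
      unfold archCoeff
      simp only [hnm, if_false]
      refine mem_of_eq (mem_offScale hS hC hnm (MI.mem_sub
        (MI.mem_sub (MI.mem_divNat hm.imP (n := 2) (by norm_num)) hm.eS)
        (MI.mem_sub (MI.mem_divNat hn.imP (n := 2) (by norm_num)) hn.eS))) ?_
      push_cast
      ring
    refine mem_of_eq (MI.mem_add hpri harch) ?_
    ring

/-- ★ **The twisted entry box is sound.**  Valid constants, prime data of the window, an off-diagonally valid
record at `n` that is also diagonally valid when `n = m`, an off-diagonally valid record at `m`, a Dirichlet
character `χ` mod `q` whose real parts at the listed prime powers are the integers `εs`, and `log q ∈ LQ`: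
`twistedGramCoeff χ a n m ∈ twistedGramBox S C εs LQ Rn Rm n m`. [cite: Yoshida1992HermitianForms, §5 (5.15)-(5.16) p. 301] -/
theorem mem_twistedGramBox (hS : 0 < S) (ha0 : 0 < a) {ks : List PrimeLen} (hks : PrimeData a ks) {C : Consts}
    (hC : ConstsValid S a ks C) (χ : DirichletCharacter ℂ q) {εs : List ℤ}
    (hε : ∀ i < ks.length, (χ (((ks.getD i default).val : ℕ) : ZMod q)).re = ((εs.getD i 0 : ℤ) : ℝ))
    {LQ : MI} (hLQ : MI.mem S (Real.log q) LQ) {n m : ℤ} {Rn Rm : IdxRec}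
    (hn : OffValid S a ks n Rn) (hnd : n = m → DiagValid S a n Rn) (hm : OffValid S a ks m Rm) :
    MI.mem S (twistedGramCoeff χ a n m) (twistedGramBox S C εs LQ Rn Rm n m) := by
  rw [twistedGramCoeff_eq_list hks χ hε]
  exact mem_twistedGramBox_list hS ha0 hC εs hLQ hn hnd hm

/-! ## The sector kernels of the door, boxed -/

/-- Box of the EVEN-sector kernel entry of the door: `M⁺(0,m) = G(0,m)`, `M⁺(i,0) = G(i,0)`,
`M⁺(i,m) = (G(i,m) + G(i,−m))/2` (`G = twistedGramCoeff χ a`; the record at `−m` is `Rm.flip`).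
[cite: Yoshida1992HermitianForms, §6 (6.10) p. 303] -/
def evenBox (S : ℕ) (C : Consts) (εs : List ℤ) (LQ : MI) (Ri Rm : IdxRec) (i m : ℕ) : MI :=
  if i = 0 then twistedGramBox S C εs LQ Ri Rm 0 m
  else if m = 0 then twistedGramBox S C εs LQ Ri Rm i 0
  else ((twistedGramBox S C εs LQ Ri Rm i m).add (twistedGramBox S C εs LQ Ri Rm.flip i (-(m : ℤ)))).divNat 2

/-- Box of the ODD-sector kernel entry of the door: `M⁻(k,l) = (G(k+1,l+1) − G(k+1,−(l+1)))/2`.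
[cite: Yoshida1992HermitianForms, §6 (6.10) p. 303] -/
def oddBox (S : ℕ) (C : Consts) (εs : List ℤ) (LQ : MI) (Rk Rl : IdxRec) (k l : ℕ) : MI :=
  ((twistedGramBox S C εs LQ Rk Rl ((k : ℤ) + 1) ((l : ℤ) + 1)).sub
    (twistedGramBox S C εs LQ Rk Rl.flip ((k : ℤ) + 1) (-((l : ℤ) + 1)))).divNat 2

/-- **Soundness of the even-sector box**: with records valid at the modes `i` (diagonally too) and `m`,
`M⁺(i,m) ∈ evenBox` (the diagonal entry `(0,0)` uses the diagonal record at `i = 0`). [cite: Moore1966, Ch. 3 (interval arithmetic: inclusion property)] -/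
theorem mem_evenBox (hS : 0 < S) (ha0 : 0 < a) {ks : List PrimeLen} (hks : PrimeData a ks) {C : Consts}
    (hC : ConstsValid S a ks C) (χ : DirichletCharacter ℂ q) {εs : List ℤ}
    (hε : ∀ i < ks.length, (χ (((ks.getD i default).val : ℕ) : ZMod q)).re = ((εs.getD i 0 : ℤ) : ℝ))
    {LQ : MI} (hLQ : MI.mem S (Real.log q) LQ) {i m : ℕ} {Ri Rm : IdxRec}
    (hi : OffValid S a ks i Ri) (hid : DiagValid S a i Ri) (hm : OffValid S a ks m Rm) :
    MI.mem S (if i = 0 then twistedGramCoeff χ a 0 m else if m = 0 then twistedGramCoeff χ a i 0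
        else (twistedGramCoeff χ a i m + twistedGramCoeff χ a i (-(m : ℤ))) / 2)
      (evenBox S C εs LQ Ri Rm i m) := by
  unfold evenBox
  by_cases hi0 : i = 0
  · subst hi0
    simp only [if_true]
    refine mem_twistedGramBox hS ha0 hks hC χ hε hLQ ?_ (fun _ ↦ ?_) hm
    · simpa using hi
    · simpa using hid
  · simp only [hi0, if_false]
    by_cases hm0 : m = 0
    · subst hm0
      simp only [if_true]
      refine mem_twistedGramBox hS ha0 hks hC χ hε hLQ hi (fun _ ↦ hid) ?_
      simpa using hm
    · simp only [hm0, if_false]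
      refine mem_of_eq (MI.mem_divNat (MI.mem_add
        (mem_twistedGramBox hS ha0 hks hC χ hε hLQ hi (fun _ ↦ hid) hm)
        (mem_twistedGramBox hS ha0 hks hC χ hε hLQ hi (fun _ ↦ hid) hm.flip)) (n := 2) (by norm_num)) ?_
      push_cast
      ring

/-- **Soundness of the odd-sector box**: `M⁻(k,l) ∈ oddBox` (records valid at the modes `k+1`, `l+1`).
[cite: Moore1966, Ch. 3 (interval arithmetic: inclusion property)] -/
theorem mem_oddBox (hS : 0 < S) (ha0 : 0 < a) {ks : List PrimeLen} (hks : PrimeData a ks) {C : Consts}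
    (hC : ConstsValid S a ks C) (χ : DirichletCharacter ℂ q) {εs : List ℤ}
    (hε : ∀ i < ks.length, (χ (((ks.getD i default).val : ℕ) : ZMod q)).re = ((εs.getD i 0 : ℤ) : ℝ))
    {LQ : MI} (hLQ : MI.mem S (Real.log q) LQ) {k l : ℕ} {Rk Rl : IdxRec}
    (hk : OffValid S a ks ((k : ℤ) + 1) Rk) (hkd : DiagValid S a ((k : ℤ) + 1) Rk) (hl : OffValid S a ks ((l : ℤ) + 1) Rl) :
    MI.mem S ((twistedGramCoeff χ a ((k : ℤ) + 1) ((l : ℤ) + 1) -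
        twistedGramCoeff χ a ((k : ℤ) + 1) (-((l : ℤ) + 1))) / 2)
      (oddBox S C εs LQ Rk Rl k l) := by
  unfold oddBox
  refine mem_of_eq (MI.mem_divNat (MI.mem_sub
    (mem_twistedGramBox hS ha0 hks hC χ hε hLQ hk (fun _ ↦ hkd) hl)
    (mem_twistedGramBox hS ha0 hks hC χ hε hLQ hk (fun _ ↦ hkd) hl.flip)) (n := 2) (by norm_num)) ?_
  push_cast
  ring

end TwistedEncl

end Summit.Ventures.WeilGRH
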